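import Summits.RiemannHypothesis.RiemannHypothesis.Theorems.AsymptoticCriticalLine.Negative.Split
import Summits.RiemannHypothesis.RiemannHypothesis.Theorems.AsymptoticCriticalLine.Negative.Truncation
import Summits.RiemannHypothesis.RiemannHypothesis.Theorems.AsymptoticCriticalLine.Negative.Scaling

/-!
# Targets: the two stubs of the picked line `interior-edge-split` — status and profile (negative lemmas, cycle 3)

The lead (prover-line-stmt-RiemannHypothesis-2063-0, PICKED.md 2026-08-16) picked line
`interior-edge-split`; its skeleton `Cruxes/AsymptoticCriticalLine/Lines/interior-edge-split.lean`
registers exactly two stubs; VERBATIM they are `RightInteriorShape riemannZeta` (stub 1, the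
lead's hardest; `rightInteriorShape_zeta_iff`) and `Split.EdgeZeroFreeShape riemannZeta` (stub 2 =
route Strip's crux stmt-10660). Disprover's
verdict: NEITHER STUB CAN BE KILLED short of `¬RH` — both follow from the crux, hence from RH
(`stubs_of_acl`, `stubs_of_riemannHypothesis`); so no `stub-false` note will come. What this file
gives the lead instead:
* forms of stub 1: it is the right-sided case of `Split.NoInteriorBandShape ζ` and EQUIVALENT to it
  (`stub1_iff_noInteriorBandShape`, reflection `ρ ↦ 1 − ρ`); its strip clauses are redundant
  (`stub1_iff_plain`); ONE instance `(σ₀, ε)` is already an eventual zero-free vertical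
  neighbourhood of `σ₀` (`eventually_zeroFree_of_window_finite`) — an open quasi-RH-type statement,
  no partial credit below the stub;
* PROFILE of stub 1 in its own (right-sided) shape `RightInteriorShape`: it FAILS for one rough Euler
  factor (`zetaTwistedAtTwo`, line `3/4`), for width (`shiftedZeta a`, line `1/2 + a`), for additive
  objects (`swF`; hence Davenport–Heilbronn, Hurwitz), for the other values `ζ − a`, for `ζ'`, and for
  the TRUNCATION `ζ₃ = 1 + 2^{−s} + 3^{−s}` (interior band at `σ₃ ≈ 0.788` with stub 2's shape TRUE:
  `rightInterior_false_edge_true_zetaPartialSum_three`); it is EXACTLY `ζ`'s stub for the tempered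
  two-band product `Z₂ = ζ(s)ζ(2s)` (`rightInterior_zetaZetaTwo_iff`, whose extra band sits at `1/4`,
  left of the line — invisible to a right-sided statement). In Beurling's world stub 1 fails with
  `θ = 1/2` integers (`BeurlingInterior.lean`, Broucke 2024 Thm 6.3). So stub 1 needs: every local
  factor exact, no width, the complete series, `ζ`'s own functional equation / non-additivity, and
  integrality beyond `θ ≥ 1/2` — the full profile of the crux minus nothing.
-/

noncomputable section

namespace Summit.RiemannHypothesis.RiemannHypothesis.Theorems.AsymptoticCriticalLine.Negative

open Complex Set
open Summit.RiemannHypothesis.RiemannHypothesis.Theses.RuelleBand (AsymptoticCriticalLine)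
open Literature.Barriers.RiemannHypothesis (zetaPartialSum)

/-! ## 0. The stubs as shapes -/

/-- The right-sided interior shape of a general `Z`. STUB 1 of the line
(`stub_noRightInteriorBand`) is VERBATIM `RightInteriorShape riemannZeta` (unfold `windowSet`), and
STUB 2 (`stub_edgeZeroFreeStrip`) is VERBATIM `EdgeZeroFreeShape riemannZeta` (`Split.lean`); both
identifications are `Iff.rfl` against the skeleton (not imported here: a `Lines/` file).
[folklore] -/
def RightInteriorShape (Z : ℂ → ℂ) : Prop :=
  ∀ σ₀ : ℝ, 1 / 2 < σ₀ → σ₀ < 1 → ∃ ε : ℝ, 0 < ε ∧ (windowSet Z σ₀ ε).Finite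

/-- Stub 1 written out (documentation of the `Iff.rfl`). [folklore] -/
theorem rightInteriorShape_zeta_iff :
    RightInteriorShape riemannZeta ↔
      ∀ σ₀ : ℝ, 1 / 2 < σ₀ → σ₀ < 1 →
        ∃ ε : ℝ, 0 < ε ∧
          {s : ℂ | riemannZeta s = 0 ∧ 0 < s.re ∧ s.re < 1 ∧ |s.re - σ₀| < ε}.Finite :=
  Iff.rfl

/-! ## 1. Status: both stubs follow from the crux, hence from RH — unkillable short of `¬RH` -/

/-- The two-sided interior shape restricts to the right-sided one. [folklore] -/
theorem rightInterior_of_noInterior (Z : ℂ → ℂ) (h : NoInteriorBandShape Z) : RightInteriorShape Z :=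
  fun σ₀ h0 h1 => h σ₀ (by linarith) h1 (ne_of_gt h0)

/-- Both stubs follow from the crux (`Split.halves_of_acl`). [folklore] -/
theorem stubs_of_acl (hacl : AsymptoticCriticalLine) :
    RightInteriorShape riemannZeta ∧ EdgeZeroFreeShape riemannZeta :=
  ⟨rightInterior_of_noInterior _ (halves_of_acl hacl).1, (halves_of_acl hacl).2⟩

/-- … hence from RH: a `stub-false` for either stub would be a disproof of RH. [folklore] -/
theorem stubs_of_riemannHypothesis (hRH : RiemannHypothesis) :
    RightInteriorShape riemannZeta ∧ EdgeZeroFreeShape riemannZeta :=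
  stubs_of_acl (acl_iff_bandSet.2 fun ε hε => by
    rw [bandSet_eq_empty_of_riemannHypothesis hRH hε]; exact finite_empty)

/-! ## 2. Forms of stub 1 -/

/-- Stub 1 is EQUIVALENT to the two-sided `NoInteriorBandShape ζ` (reflection `ρ ↦ 1 − ρ`,
tree `riemannZeta_one_sub_eq_zero`). [folklore] -/
theorem stub1_iff_noInteriorBandShape : RightInteriorShape riemannZeta ↔ NoInteriorBandShape riemannZeta := by
  refine ⟨fun h σ₀ h0 h1 hne => ?_, rightInterior_of_noInterior _⟩
  rcases lt_or_gt_of_ne hne with hlt | hgt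
  · obtain ⟨ε, hε, hfin⟩ := h (1 - σ₀) (by linarith) (by linarith)
    refine ⟨ε, hε, (hfin.image fun s => 1 - s).subset ?_⟩
    rintro s ⟨hz, hs0, hs1, hw⟩
    refine ⟨1 - s, ⟨?_, ?_, ?_, ?_⟩, by ring⟩
    · exact Literature.NumberTheory.LFunctions.GeneralizedRH.riemannZeta_one_sub_eq_zero hz hs0 hs1
    · simp only [sub_re, one_re]; linarith
    · simp only [sub_re, one_re]; linarith
    · simp only [sub_re, one_re]
      rw [show 1 - s.re - (1 - σ₀) = -(s.re - σ₀) by ring, abs_neg]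
      exact hw
  · exact h σ₀ hgt h1

/-- The strip clauses of stub 1 are redundant (choose `ε ≤ min (σ₀ − 1/2) (1 − σ₀)`). [folklore] -/
theorem stub1_iff_plain :
    RightInteriorShape riemannZeta ↔
      ∀ σ₀ : ℝ, 1 / 2 < σ₀ → σ₀ < 1 →
        ∃ ε : ℝ, 0 < ε ∧ {s : ℂ | riemannZeta s = 0 ∧ |s.re - σ₀| < ε}.Finite := by
  refine ⟨fun h σ₀ h0 h1 => ?_, fun h σ₀ h0 h1 => ?_⟩
  · obtain ⟨ε, hε, hfin⟩ := h σ₀ h0 h1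
    set r : ℝ := min ε (min (σ₀ - 1 / 2) (1 - σ₀)) with hr
    have hr0 : 0 < r := lt_min hε (lt_min (by linarith) (by linarith))
    have hrε : r ≤ ε := min_le_left _ _
    have hr1 : r ≤ σ₀ - 1 / 2 := (min_le_right _ _).trans (min_le_left _ _)
    have hr2 : r ≤ 1 - σ₀ := (min_le_right _ _).trans (min_le_right _ _)
    refine ⟨r, hr0, hfin.subset ?_⟩
    rintro s ⟨hz, hw⟩
    obtain ⟨hw1, hw2⟩ := abs_sub_lt_iff.1 hw
    exact ⟨hz, by linarith, by linarith, abs_sub_lt_iff.2 ⟨by linarith, by linarith⟩⟩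
  · obtain ⟨ε, hε, hfin⟩ := h σ₀ h0 h1
    exact ⟨ε, hε, hfin.subset fun s ⟨hz, _, _, hw⟩ => ⟨hz, hw⟩⟩

/-- NO PARTIAL CREDIT below stub 1: finiteness of ONE window is already an eventual zero-free
VERTICAL NEIGHBOURHOOD of `σ₀` — `ζ ≠ 0` for `|Re s − σ₀| < ε`, `|Im s| > T` — an open
quasi-RH-type statement at every `σ₀ ∈ (1/2, 1)` (zeros in a compact set are finite, so "finite"
and "bounded in height" agree). [folklore] -/
theorem eventually_zeroFree_of_window_finite {σ₀ ε : ℝ}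
    (h : {s : ℂ | riemannZeta s = 0 ∧ |s.re - σ₀| < ε}.Finite) :
    ∃ T : ℝ, ∀ s : ℂ, |s.re - σ₀| < ε → T < |s.im| → riemannZeta s ≠ 0 := by
  obtain ⟨T, hT⟩ := (h.image fun s : ℂ => |s.im|).bddAbove
  refine ⟨T, fun s hw him hz => ?_⟩
  have := hT ⟨s, ⟨hz, hw⟩, rfl⟩
  exact (lt_irrefl T) (him.trans_le this)

/-! ## 3. Profile of stub 1 in its own right-sided shape -/

/-- A populated vertical line `Re s = σ₀`, `σ₀ ∈ (1/2, 1)`, kills the right-sided shape. [folklore] -/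
theorem not_rightInterior_of_line {Z : ℂ → ℂ} {σ₀ : ℝ} (h0 : 1 / 2 < σ₀) (h1 : σ₀ < 1)
    (hinf : {t : ℝ | Z ((σ₀ : ℂ) + t * I) = 0}.Infinite) : ¬ RightInteriorShape Z := by
  intro h
  obtain ⟨ε, hε, hfin⟩ := h σ₀ h0 h1
  have hsub : (fun t : ℝ => (σ₀ : ℂ) + t * I) '' {t : ℝ | Z ((σ₀ : ℂ) + t * I) = 0}
      ⊆ windowSet Z σ₀ ε := by
    rintro _ ⟨t, ht, rfl⟩
    refine ⟨ht, ?_, ?_, ?_⟩ <;>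
      simp only [add_re, ofReal_re, mul_re, I_re, mul_zero, ofReal_im, I_im, mul_one, sub_self,
        add_zero, abs_zero] <;> linarith
  have hinj : Set.InjOn (fun t : ℝ => (σ₀ : ℂ) + t * I) {t : ℝ | Z ((σ₀ : ℂ) + t * I) = 0} := by
    intro a _ b _ hab
    have h' := congrArg Complex.im hab
    simpa using h'
  exact (hinf.image hinj).mono hsub hfin

/-- Infinitely many zeros in every strip `1/2 < σ₁ < σ < σ₂ < 1` kill the right-sided shape. [folklore] -/
theorem not_rightInterior_of_strips {Z : ℂ → ℂ}
    (h : ∀ σ₁ σ₂ : ℝ, 1 / 2 < σ₁ → σ₁ < σ₂ → σ₂ < 1 →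
      {s : ℂ | Z s = 0 ∧ σ₁ < s.re ∧ s.re < σ₂}.Infinite) :
    ¬ RightInteriorShape Z := by
  intro hR
  obtain ⟨ε, hε, hfin⟩ := hR (3 / 4) (by norm_num) (by norm_num)
  have hε' : 0 < min ε (1 / 8) := lt_min hε (by norm_num)
  have hε8 : min ε (1 / 8) ≤ 1 / 8 := min_le_right _ _
  have hεε : min ε (1 / 8) ≤ ε := min_le_left _ _
  refine h (3 / 4 - min ε (1 / 8)) (3 / 4 + min ε (1 / 8)) (by linarith) (by linarith) (by linarith)
    (hfin.subset ?_)
  rintro s ⟨hz, hlo, hhi⟩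
  exact ⟨hz, by linarith, by linarith, abs_sub_lt_iff.2 ⟨by linarith, by linarith⟩⟩

/-- STUB 1's SHAPE FAILS for `ζ` with one non-tempered local factor (line `3/4`). [folklore] -/
theorem not_rightInterior_zetaTwistedAtTwo : ¬ RightInteriorShape zetaTwistedAtTwo := by
  refine not_rightInterior_of_line (σ₀ := 3 / 4) (by norm_num) (by norm_num) ?_
  have hsub : Set.range (fun k : ℕ => (2 * Real.pi / Real.log 2 * k : ℝ))
      ⊆ {t : ℝ | zetaTwistedAtTwo (((3 / 4 : ℝ) : ℂ) + t * I) = 0} := by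
    rintro _ ⟨k, rfl⟩
    exact zetaTwistedAtTwo_secondBandPt k
  have hinj : Function.Injective (fun k : ℕ => (2 * Real.pi / Real.log 2 * k : ℝ)) := by
    intro a b hab
    have hc : (2 * Real.pi / Real.log 2 : ℝ) ≠ 0 :=
      div_ne_zero (by positivity) (Real.log_pos one_lt_two).ne'
    exact_mod_cast mul_left_cancel₀ hc hab
  exact (Set.infinite_range_of_injective hinj).mono hsub

/-- STUB 1's SHAPE FAILS for the width-`2a` object `ζ(s−a)ζ(s+a)` (line `1/2 + a`). [folklore] -/
theorem not_rightInterior_shiftedZeta {a : ℝ} (ha0 : 0 < a) (ha : a < 1 / 2) :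
    ¬ RightInteriorShape (Literature.Barriers.RiemannHypothesis.RamanujanAxiom.shiftedZeta a) := by
  refine not_rightInterior_of_line (σ₀ := 1 / 2 + a) (by linarith) (by linarith) ?_
  have hinf := (Literature.Barriers.RiemannHypothesis.RamanujanAxiom.shiftedZeta_zeros_infinite a).1
  have heq : (((1 / 2 + a : ℝ) : ℂ)) = 1 / 2 + (a : ℂ) := by push_cast; ring
  simpa only [heq] using hinf

/-- STUB 1's SHAPE FAILS for the additive object `swF = L(χ₃) + L(χ₅)` (so for Davenport–Heilbronn
and `ζ(s,1/5)`). [folklore] -/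
theorem not_rightInterior_swF : ¬ RightInteriorShape swF :=
  not_rightInterior_of_strips fun _ _ h1 h12 h2 => swF_zeros_infinite h1.le h12 h2.le

/-- STUB 1's SHAPE FAILS for `ζ − a`, `a ≠ 0`. [folklore] -/
theorem not_rightInterior_zeta_sub_const {a : ℂ} (ha : a ≠ 0) :
    ¬ RightInteriorShape (fun s => riemannZeta s - a) :=
  not_rightInterior_of_strips fun _ _ h1 h12 h2 => zeta_sub_const_zeros_infinite ha h1 h12 h2

/-- STUB 1's SHAPE FAILS for `ζ'`. [folklore] -/
theorem not_rightInterior_deriv_zeta : ¬ RightInteriorShape (deriv riemannZeta) :=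
  not_rightInterior_of_strips fun _ _ h1 h12 h2 => deriv_zeta_zeros_infinite h1 h12 h2

/-- STUB 1's SHAPE FAILS, STUB 2's SHAPE HOLDS for the truncation `ζ₃ = 1 + 2^{−s} + 3^{−s}`
(unconditional; `Truncation.zetaPartialSum_three_interior_band`). [folklore] -/
theorem rightInterior_false_edge_true_zetaPartialSum_three :
    ¬ RightInteriorShape (zetaPartialSum 3) ∧ EdgeZeroFreeShape (zetaPartialSum 3) := by
  obtain ⟨σ₃, hlo, hhi, hwin, hright⟩ := zetaPartialSum_three_interior_band
  refine ⟨fun h => ?_, ⟨1 - σ₃, by linarith, fun s hz hlo' _ => by have := hright s hz; linarith⟩⟩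
  obtain ⟨ε, hε, hfin⟩ := h σ₃ hlo hhi
  set r : ℝ := min ε (min (σ₃ - 1 / 2) (1 - σ₃)) with hr
  have hr0 : 0 < r := lt_min hε (lt_min (by linarith) (by linarith))
  have hrε : r ≤ ε := min_le_left _ _
  have hr1 : r ≤ σ₃ - 1 / 2 := (min_le_right _ _).trans (min_le_left _ _)
  have hr2 : r ≤ 1 - σ₃ := (min_le_right _ _).trans (min_le_right _ _)
  refine hwin r hr0 (hfin.subset ?_)
  rintro s ⟨hz, hw⟩
  obtain ⟨hw1, hw2⟩ := abs_sub_lt_iff.1 hw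
  exact ⟨hz, by linarith, by linarith, abs_sub_lt_iff.2 ⟨by linarith, by linarith⟩⟩

/-- STUB 1's SHAPE for the tempered two-band Euler product `Z₂ = ζ(s)ζ(2s)` is EXACTLY stub 1
(the extra band of `Z₂` sits at `1/4`, left of the line; shrink `ε ≤ σ₀ − 1/2`). A right-sided
statement does not see left bands — for `ζ` harmless (reflection), for the engine's output type a
point to keep in mind. [folklore] -/
theorem rightInterior_zetaZetaTwo_iff : RightInteriorShape zetaZetaTwo ↔ RightInteriorShape riemannZeta := by
  refine ⟨fun h σ₀ h0 h1 => ?_, fun h σ₀ h0 h1 => ?_⟩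
  · obtain ⟨ε, hε, hfin⟩ := h σ₀ h0 h1
    exact ⟨ε, hε, hfin.subset fun s ⟨hz, hs0, hs1, hw⟩ =>
      ⟨by rw [zetaZetaTwo, hz, zero_mul], hs0, hs1, hw⟩⟩
  · obtain ⟨ε, hε, hfin⟩ := h σ₀ h0 h1
    refine ⟨min ε (σ₀ - 1 / 2), lt_min hε (by linarith), hfin.subset ?_⟩
    rintro s ⟨hz, hs0, hs1, hw⟩
    obtain ⟨hw1, hw2⟩ := abs_sub_lt_iff.1 hw
    have hs : 1 / 2 ≤ s.re := by linarith [min_le_right ε (σ₀ - 1 / 2)]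
    exact ⟨(zetaZetaTwo_eq_zero_iff hs).1 hz, hs0, hs1,
      abs_sub_lt_iff.2 ⟨by linarith [min_le_left ε (σ₀ - 1 / 2)], by linarith [min_le_left ε (σ₀ - 1 / 2)]⟩⟩

end Summit.RiemannHypothesis.RiemannHypothesis.Theorems.AsymptoticCriticalLine.Negative
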